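import Summits.RiemannHypothesis.RiemannHypothesis.Theses.ScrewPolyaSigns
import Literature.NumberTheory.LFunctions.ZetaScrewThm17Proofs
import Literature.NumberTheory.LFunctions.RiemannHypothesisUpTo100000X
import HarnessLib

/-!
# `ScrewPolyaSigns.AssemblyR` (stmt-RiemannHypothesis-24465): the bridge `PolyaLandauR → ScrewSignSparse → RH`

Route `route-RiemannHypothesis-ScrewPolyaSigns` (L49, BRIEF-L49 §4), support item.  Under `¬RH` let
`Θ = sup re ρ` over the zeros of `ζ` in `1/2 < re < 1` and `θ₀ = Θ − 1/2`; `PolyaLandauR` (stmt-24464, the printed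
Pólya–Landau–Grosswald theorem in meromorphic form) is applied ONCE with `g = Ψ ∘ log` (`Ψ = zetaScrew`), `σ₁ = 1`,
`θ = θ₀`, `b = 1`, `η = min(θ₀/2, (10⁵ − πD)/2)` and `Φ = R(s) = s⁻² ξ′/ξ(1/2+s)`.  Every hypothesis is a named tree
fact: `continuous_zetaScrew`, `ZetaScrewLandau.integrableOn_zetaScrew_log_rpow`, `ZetaScrewLandau.mellinIoi_eq_of_re_gt`,
`ZetaScrewLandau.differentiableAt_R`, and the verified height `riemannHypothesisInStripUpTo_100000` (which makes `R`
holomorphic on the box `{θ₀ − η < re, |im| < πD + η}` because `πD < 10⁵` is exactly `ScrewSignSparse`'s constant);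
meromorphy of `R` is Mathlib's `AnalyticAt.meromorphicAt` API (ξ entire).  The sup is approached by a zero inside the
half-plane `{θ₀ − ε < re}` returned by `PolyaLandauR`, and the endgame is the order comparison at that zero exactly as
in `ZetaScrewLandau.riemannXi_ne_zero_of_zetaScrew_nonneg` (identity theorem from a neighbourhood of `2`, then
`analyticOrderAt` of `Φ′·s²·ξ(1/2+s)` versus `ξ′(1/2+s)`).  Computational lane by inheritance (the `10⁵` strip
certificate's `native_decide` auxiliaries); otherwise standard axioms.  Proof found and kernel-checked by referee
rh-split-ref-2 g8 (probe `AssemblyR_proof_ref2.lean` 7edffc75b9a3f8ea); filed by a typer per director (AQ1)/(AQ2).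
A SUPPORT item: it credits nothing toward RH — the cruxes `PolyaLandauR` (24464) and `ScrewSignSparse` (24182,
RH-implied) stay open.  Nothing here bears on the truth of RH.
-/

-- D-0017: `Summit.RiemannHypothesis.RiemannHypothesis.…` duplicates the namespace BY DESIGN (single-problem summit).
set_option linter.dupNamespace false

noncomputable section

open Complex Filter Topology Set MeasureTheory
open scoped Real
open Literature.NumberTheory.LFunctions

namespace Summit.RiemannHypothesis.RiemannHypothesis.Theorems.ScrewPolyaSignsAssemblyR

open Summit.RiemannHypothesis.RiemannHypothesis.Theses.ScrewPolyaSigns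

/-- `R(s) = s⁻² ξ′/ξ(1/2+s)` unfolded: `R(s) = s⁻² · ξ′(1/2+s) / ξ(1/2+s)` (the tree states `R` as this
lambda, cf. `ZetaScrewLandau.differentiableAt_R`, `ZetaScrewLandau.mellinIoi_eq_of_re_gt`). -/
theorem R_eq : (fun s : ℂ ↦ 1 / s ^ 2 * logDeriv riemannXi (1 / 2 + s)) =
    fun s : ℂ ↦ (1 / s ^ 2) * (deriv riemannXi (1 / 2 + s) / riemannXi (1 / 2 + s)) := by
  funext s; rw [logDeriv_apply]

/-- `R(s) = s⁻² ξ′/ξ(1/2+s)` is meromorphic everywhere (ξ entire). -/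
theorem meromorphicOn_R (U : Set ℂ) :
    MeromorphicOn (fun s : ℂ ↦ 1 / s ^ 2 * logDeriv riemannXi (1 / 2 + s)) U := fun s _ ↦ by
  have h1 : AnalyticAt ℂ (fun _ : ℂ ↦ (1 : ℂ)) s := analyticAt_const
  have h2 : AnalyticAt ℂ (fun s : ℂ ↦ s ^ 2) s := analyticAt_id.pow 2
  have hT : AnalyticAt ℂ (fun s : ℂ ↦ (1 / 2 : ℂ) + s) s := analyticAt_const.add analyticAt_id
  have h3 : AnalyticAt ℂ (fun s : ℂ ↦ riemannXi (1 / 2 + s)) s :=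
    (differentiable_riemannXi.analyticAt _).comp hT
  have h4 : AnalyticAt ℂ (fun s : ℂ ↦ deriv riemannXi (1 / 2 + s)) s :=
    (differentiable_riemannXi.analyticAt _).deriv.comp hT
  rw [R_eq]
  exact (h1.meromorphicAt.div h2.meromorphicAt).mul (h4.meromorphicAt.div h3.meromorphicAt)

/-- **The bridge `AssemblyR` (stmt-RiemannHypothesis-24465).** -/
theorem assemblyR : AssemblyR := by
  unfold AssemblyR
  intro hPLR hSSS
  refine (Summit.RiemannHypothesis_iff).2 (quasiRiemannHypothesis_one_half_iff_holds.1 ?_)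
  by_contra hQ
  -- the real parts of the zeros in the right half of the strip
  set S : Set ℝ := {σ | ∃ s : ℂ, riemannZeta s = 0 ∧ 1 / 2 < s.re ∧ s.re < 1 ∧ s.re = σ} with hS_def
  have hSne : S.Nonempty := by
    by_contra hne
    refine hQ fun s hs h1 h2 ↦ hne ⟨s.re, s, hs, h1, h2, rfl⟩
  have hSbdd : BddAbove S := ⟨1, fun σ ⟨s, _, _, h2, hσ⟩ ↦ hσ ▸ h2.le⟩
  set Θ : ℝ := sSup S with hΘ_def
  have hΘgt : 1 / 2 < Θ := by
    obtain ⟨σ, hσ⟩ := hSne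
    have hσ' : σ ∈ S := hσ
    obtain ⟨s, _, h1, _, hs⟩ := hσ'
    exact lt_of_lt_of_le (hs ▸ h1) (le_csSup hSbdd hσ)
  have hΘle : Θ ≤ 1 := csSup_le hSne fun σ ⟨s, _, _, h2, hσ⟩ ↦ hσ ▸ h2.le
  -- no zero of `ξ(1/2 + ·)` to the right of `θ₀ = Θ - 1/2`
  have hfree : ∀ s : ℂ, Θ - 1 / 2 < s.re → riemannXi (1 / 2 + s) ≠ 0 := by
    intro s hs hξ
    obtain ⟨hζ, h0, h1, -⟩ := riemannXi_zero_prop hξ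
    have hre : (1 / 2 + s : ℂ).re = 1 / 2 + s.re := by simp
    by_cases hhalf : 1 / 2 < (1 / 2 + s : ℂ).re
    · have hmem : (1 / 2 + s : ℂ).re ∈ S := ⟨1 / 2 + s, hζ, hhalf, h1, rfl⟩
      have := le_csSup hSbdd hmem
      rw [hre] at this
      linarith
    · rw [hre] at hhalf
      linarith
  set θ₀ : ℝ := Θ - 1 / 2 with hθ₀_def
  have hθ₀ : 0 < θ₀ := by rw [hθ₀_def]; linarith
  have hθ₀' : θ₀ ≤ 1 / 2 := by rw [hθ₀_def]; linarith
  obtain ⟨D, B, hπD, hchain⟩ := hSSS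
  set η : ℝ := min (θ₀ / 2) ((100000 - Real.pi * D) / 2) with hη_def
  have hη : 0 < η := lt_min (by positivity) (by linarith)
  have hη1 : η ≤ θ₀ / 2 := min_le_left _ _
  have hη2 : η ≤ (100000 - Real.pi * D) / 2 := min_le_right _ _
  set g : ℝ → ℝ := fun x ↦ zetaScrew (Real.log x) with hg_def
  -- (H1) continuity on (1, ∞)
  have hg_cont : ContinuousOn g (Ioi 1) :=
    continuous_zetaScrew.comp_continuousOn
      (Real.continuousOn_log.mono fun x hx ↦ (zero_lt_one.trans (by exact hx)).ne')
  -- (H2) integrability at σ₁ = 1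
  have hg_int : IntegrableOn (fun x : ℝ ↦ g x * x ^ (-((1 : ℝ) + 1))) (Ioi 1) :=
    ZetaScrewLandau.integrableOn_zetaScrew_log_rpow (by norm_num)
  -- (H3) chain bound transported by t = log x
  have hg_chain : ∀ X : ℝ, 1 ≤ X → ∀ (n : ℕ) (x : Fin (n + 1) → ℝ), StrictMono x →
      (∀ i, x i ∈ Set.Ioc 1 X) → (∀ i : Fin n, g (x i.castSucc) * g (x i.succ) < 0) →
      (n : ℝ) ≤ D * Real.log X + B := by
    intro X hX n x hmono hmem halt
    refine hchain (Real.log X) (Real.log_nonneg hX) n (fun i ↦ Real.log (x i)) ?_ ?_ ?_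
    · exact fun i j hij ↦ Real.log_lt_log (zero_lt_one.trans (hmem i).1) (hmono hij)
    · intro i
      exact ⟨(Real.log_pos (hmem i).1).le,
        Real.log_le_log (zero_lt_one.trans (hmem i).1) (hmem i).2⟩
    · intro i
      exact halt i
  -- (H7) holomorphy of R on {θ₀ < re} ∪ the pole-free box (verified height 10⁵)
  have hdiff : DifferentiableOn ℂ (fun s : ℂ ↦ 1 / s ^ 2 * logDeriv riemannXi (1 / 2 + s))
      ({s : ℂ | θ₀ < s.re} ∪ {s : ℂ | θ₀ - η < s.re ∧ |s.im| < Real.pi * D + η}) := by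
    intro s hs
    refine (ZetaScrewLandau.differentiableAt_R ?_ ?_).differentiableWithinAt
    · intro h0
      rcases hs with hs | hs
      · simp only [Set.mem_setOf_eq, h0, zero_re] at hs; linarith
      · have := hs.1; rw [h0, zero_re] at this; linarith
    · rcases hs with hs | hs
      · exact hfree s hs
      · intro hξ
        obtain ⟨hζ, h0, h1, -⟩ := riemannXi_zero_prop hξ
        have hre : (1 / 2 + s : ℂ).re = 1 / 2 + s.re := by simp
        have him : (1 / 2 + s : ℂ).im = s.im := by simp
        have habs : |(1 / 2 + s : ℂ).im| ≤ 100000 := by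
          rw [him]; linarith [hs.2]
        have := riemannHypothesisInStripUpTo_100000 (1 / 2 + s) hζ h0 h1 habs
        rw [hre] at this
        linarith [hs.1]
  -- (H8) R = mellinIoi g on re s > 1
  have heq : EqOn (fun s : ℂ ↦ 1 / s ^ 2 * logDeriv riemannXi (1 / 2 + s)) (Landau.mellinIoi g)
      {s : ℂ | (1 : ℝ) < s.re} := fun s hs ↦
    (ZetaScrewLandau.mellinIoi_eq_of_re_gt (by simp only [Set.mem_setOf_eq] at hs; linarith)).symm
  -- apply Pólya–Landau–Grosswald
  obtain ⟨ε, hε, Φ', hΦ'diff, hΦ'eq⟩ := hPLR g 1 θ₀ 1 η D B hg_cont hg_int hg_chain (by linarith)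
    one_pos hη (fun s : ℂ ↦ 1 / s ^ 2 * logDeriv riemannXi (1 / 2 + s)) (meromorphicOn_R _) hdiff heq
  -- a zero `1/2 + w₀` with `θ₀ - ε < re w₀`
  obtain ⟨σ, hσS, hσgt⟩ := exists_lt_of_lt_csSup hSne (show Θ - ε < Θ by linarith)
  obtain ⟨s₁, hζ₁, h1₁, h2₁, hs₁σ⟩ := hσS
  set w₀ : ℂ := s₁ - 1 / 2 with hw₀_def
  have hzero : riemannXi (1 / 2 + w₀) = 0 := by
    rw [hw₀_def, show (1 / 2 : ℂ) + (s₁ - 1 / 2) = s₁ by ring]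
    exact (riemannXi_eq_zero_iff_holds s₁).2 ⟨hζ₁, by linarith, h2₁⟩
  -- ENDGAME (tree block of `ZetaScrewLandau.riemannXi_ne_zero_of_zetaScrew_nonneg`, with F := Φ')
  set H : Set ℂ := {s : ℂ | θ₀ - ε < s.re} with hH_def
  have hHo : IsOpen H := isOpen_lt continuous_const Complex.continuous_re
  have hHpre : IsPreconnected H := (convex_halfSpace_re_gt (θ₀ - ε)).isPreconnected
  set Z : ℂ → ℂ := fun s ↦ riemannXi (1 / 2 + s) with hZ_def
  have hZd : Differentiable ℂ Z := differentiable_riemannXi.comp (by fun_prop)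
  have hZa : ∀ s, AnalyticAt ℂ Z s := fun s ↦ hZd.analyticAt s
  have hderivZ : ∀ s, deriv Z s = deriv riemannXi (1 / 2 + s) := fun s ↦ by
    simp only [hZ_def]
    exact deriv_comp_const_add riemannXi (1 / 2) s
  set G : ℂ → ℂ := fun s ↦ Φ' s * s ^ 2 with hG_def
  have hGa : ∀ s ∈ H, AnalyticAt ℂ G s := fun s hs ↦
    ((hΦ'diff.analyticOnNhd hHo) s hs).mul ((analyticAt_id.pow 2))
  have hf₁ : AnalyticOnNhd ℂ (G * Z) H := fun s hs ↦ (hGa s hs).mul (hZa s)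
  have hf₂ : AnalyticOnNhd ℂ (deriv Z) H := fun s _ ↦ (hZa s).deriv
  have h2H : (2 : ℂ) ∈ H := by
    simp only [hH_def, Set.mem_setOf_eq]
    norm_num
    linarith
  have hev2 : (G * Z) =ᶠ[𝓝 (2 : ℂ)] deriv Z := by
    have hopen : IsOpen {s : ℂ | (1 : ℝ) < s.re} := isOpen_lt continuous_const Complex.continuous_re
    filter_upwards [hopen.mem_nhds (show (2 : ℂ) ∈ {s : ℂ | (1 : ℝ) < s.re} by simp)] with s hs
    have hs' : (1 : ℝ) < s.re := hs
    have hξ : riemannXi (1 / 2 + s) ≠ 0 := riemannXi_ne_zero_of_one_le_re (by simp; linarith)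
    have hs0 : s ≠ 0 := fun h ↦ by rw [h, zero_re] at hs'; linarith
    rw [Pi.mul_apply, hderivZ s]
    simp only [hG_def, hZ_def]
    rw [hΦ'eq hs, ← heq hs]
    simp only [logDeriv_apply]
    set A : ℂ := deriv riemannXi (1 / 2 + s)
    set B' : ℂ := riemannXi (1 / 2 + s)
    field_simp
  have hEqOn : EqOn (G * Z) (deriv Z) H := hf₁.eqOn_of_preconnected_of_eventuallyEq hf₂ hHpre h2H hev2
  have hw₀H : w₀ ∈ H := by
    simp only [hH_def, hw₀_def, Set.mem_setOf_eq, sub_re]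
    norm_num
    rw [hθ₀_def]
    linarith
  have hev : deriv Z =ᶠ[𝓝 w₀] G * Z := by
    filter_upwards [hHo.mem_nhds hw₀H] with s hs
    exact (hEqOn hs).symm
  have hZ0 : Z w₀ = 0 := hzero
  have h1 : analyticOrderAt (deriv Z) w₀ + 1 = analyticOrderAt Z w₀ := by
    have := (hZa w₀).analyticOrderAt_deriv_add_one
    simpa [hZ0] using this
  have h2 : analyticOrderAt (deriv Z) w₀ = analyticOrderAt G w₀ + analyticOrderAt Z w₀ := by
    rw [analyticOrderAt_congr hev, analyticOrderAt_mul (hGa w₀ hw₀H) (hZa w₀)]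
  rw [h2] at h1
  generalize hoZ : analyticOrderAt Z w₀ = oZ at h1
  generalize hoG : analyticOrderAt G w₀ = oG at h1
  cases oZ with
  | top =>
    have hloc : ∀ᶠ s in 𝓝 w₀, Z s = 0 := analyticOrderAt_eq_top.1 hoZ
    have hall : EqOn Z 0 univ :=
      (hZd.differentiableOn.analyticOnNhd isOpen_univ).eqOn_zero_of_preconnected_of_eventuallyEq_zero
        isPreconnected_univ (Set.mem_univ w₀) hloc
    have h1' : Z 1 = 0 := hall (Set.mem_univ 1)
    simp only [hZ_def] at h1'
    exact riemannXi_ne_zero_of_one_le_re (s := 1 / 2 + 1) (by norm_num) h1'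
  | coe n =>
    cases oG with
    | top => simp at h1
    | coe m =>
      have h' : (m + n + 1 : ℕ) = n := by exact_mod_cast h1
      omega

end Summit.RiemannHypothesis.RiemannHypothesis.Theorems.ScrewPolyaSignsAssemblyR

end
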